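import Summits.NavierStokesRegularity.NavierStokesRegularity.Theorems.ExtremiserTransienceNearExtremalTransienceExtremiserLiouvilleConstantSpeedSlidePalinstrophyRemainder
import HarnessLib

/-!
# Crux `ExtremiserTransience.NearExtremalTransience` (stmt-NavierStokesRegularity-21883), line `extremiser_liouville`,
# stub K1b — THE REGULARISED PALINSTROPHY DENSITY, EXPLICITLY (record §14, step R6a-Z, pointwise part)

`--supports stmt-NavierStokesRegularity-21883` (helper).  Author: prover seat `ns-el-k1b` (g9).

`slideInequality` (…SlideInequality) contains the regularised palinstrophy variation
`ĉ₁ = −½∫g′|Dω|²_F − ∫Σᵢ⟪∂ᵢω, (∂₂R)bᵢ⟫ + ∫Σᵢ⟪∂ᵢω, (DK₁bᵢ)e₀ − (DK₀bᵢ)e₁⟫` with the remainder `R = D(curl(gV)) − gDω`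
and `Kⱼ = ∂ⱼ(g′V₂)` left unexpanded.  This file expands the two densities POINTWISE in terms of `V, DV, D²V`, `ω = curl V`,
`Dω`, the cross field `B = (−V₁, V₀, 0)` and `g′, g″, g‴` (the `γ, γ′, γ″`-part of identity (Z) of record §11):
* `fderiv_apply_comm_const` : `(Dc(x)u)w = D(y ↦ c(y)w)(x)u` for `L(ℝ³,ℝ³)`-valued `c`;
* `fderiv_curlRemainder_axis_apply` : `(∂₂R)(x)w = w₂(g″ω + g′∂₂ω) + ∂₂∂_w(g′B)`;
* `fderiv_fderiv_axialWeight_smul_apply` : `∂_u∂_w(τ(x₂)B′) = τ′u₂∂_wB′ + τ∂_u∂_wB′ + τ″u₂w₂B′ + τ′w₂∂_uB′`;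
* `fderiv_slideCoeffDeriv_apply` : `DKⱼ(x)w = g″w₂(∂ⱼV)₂ + g′(∂_w∂ⱼV)₂` (`j = 0, 1`);
* `sum_inner_fderiv_curlRemainder_axis` : **`Σᵢ⟪∂ᵢω,(∂₂R)bᵢ⟫ = g″⟪∂₂ω,ω⟫ + g′|∂₂ω|² + g‴⟪∂₂ω,B⟫ + g″⟪∂₂ω,∂₂B⟫
  + Σᵢ(g″⟪∂ᵢω, ∂ᵢB⟫ + g′⟪∂ᵢω, ∂₂∂ᵢB⟫)`**;
* `sum_inner_slideCoeffDeriv` : **`Σᵢ⟪∂ᵢω,(DK₁bᵢ)e₀ − (DK₀bᵢ)e₁⟫ = g″((∂₂ω)₀(∂₁V)₂ − (∂₂ω)₁(∂₀V)₂)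
  + g′Σᵢ((∂ᵢω)₀(∂ᵢ∂₁V)₂ − (∂ᵢω)₁(∂ᵢ∂₀V)₂)`**.
So the `ĉ₁`-integrand is an explicit quadratic form in `(DV, D²V)` with weights `g′, g″, g‴` — no third derivative of `V` —
ready for the integrations by parts of record §2 ((T1), (T2), (C)) and the absorption step R6b.

WHAT THIS IS NOT: K1b is NOT proved; nothing here proves NS regularity. [folklore]
-/

noncomputable section

open Set Filter Topology MeasureTheory Metric Function InnerProductSpace
open scoped ENNReal NNReal Topology InnerProductSpace RealInnerProductSpace ContDiff
open Literature.Analysis.FluidPDE Literature.Analysis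

namespace Summit.NavierStokesRegularity.NavierStokesRegularity.Theorems

-- the problem directory repeats the summit name (`NavierStokesRegularity/NavierStokesRegularity`)
set_option linter.dupNamespace false

namespace ExtremiserLiouville

open DepletionLadder.KStar

variable {V : EuclideanSpace ℝ (Fin 3) → EuclideanSpace ℝ (Fin 3)} {g : ℝ → ℝ}

/-! ## 1. Calculus tools -/

/-- For a differentiable `L(ℝ³,F)`-valued map `c` and fixed `w`: `(Dc(x)u)(w) = D(y ↦ c(y)w)(x)u`. [folklore] -/
theorem fderiv_apply_comm_const {F' : Type*} [NormedAddCommGroup F'] [NormedSpace ℝ F']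
    {c : EuclideanSpace ℝ (Fin 3) → (EuclideanSpace ℝ (Fin 3) →L[ℝ] F')} {x : EuclideanSpace ℝ (Fin 3)}
    (hc : DifferentiableAt ℝ c x) (u w : EuclideanSpace ℝ (Fin 3)) :
    fderiv ℝ c x u w = fderiv ℝ (fun y => c y w) x u := by
  have h := hc.hasFDerivAt.clm_apply (hasFDerivAt_const w x)
  rw [h.fderiv]
  simp [ContinuousLinearMap.flip_apply]

/-- Product rule for `τ(x₂)·F(x)` applied to a vector: `D(τ(x₂)F)(y)w = τ(y₂)DF(y)w + (τ′(y₂)w₂)F(y)`. [folklore] -/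
theorem fderiv_axialWeight_smul_apply {F : EuclideanSpace ℝ (Fin 3) → EuclideanSpace ℝ (Fin 3)} {τ : ℝ → ℝ}
    (hF : Differentiable ℝ F) (hτ : Differentiable ℝ τ) (y w : EuclideanSpace ℝ (Fin 3)) :
    fderiv ℝ (fun z : EuclideanSpace ℝ (Fin 3) => τ (z 2) • F z) y w = τ (y 2) • fderiv ℝ F y w + (deriv τ (y 2) * w 2) • F y := by
  rw [(hasFDerivAt_axialWeight_smul hF hτ y).fderiv]
  simp only [add_apply, smul_apply, ContinuousLinearMap.smulRight_apply, proj_two_apply, smul_eq_mul]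

/-- **Second derivative of `τ(x₂)B′`**:
`∂_u∂_w(τ(x₂)B′)(x) = τ′(x₂)u₂·∂_wB′ + τ(x₂)·∂_u∂_wB′ + τ″(x₂)u₂w₂·B′ + τ′(x₂)w₂·∂_uB′`. [folklore] -/
theorem fderiv_fderiv_axialWeight_smul_apply {F : EuclideanSpace ℝ (Fin 3) → EuclideanSpace ℝ (Fin 3)} {τ : ℝ → ℝ}
    (hF : ContDiff ℝ ∞ F) (hτ : ContDiff ℝ ∞ τ) (x w u : EuclideanSpace ℝ (Fin 3)) :
    fderiv ℝ (fun y : EuclideanSpace ℝ (Fin 3) => fderiv ℝ (fun z : EuclideanSpace ℝ (Fin 3) => τ (z 2) • F z) y w) x u =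
      (deriv τ (x 2) * u 2) • fderiv ℝ F x w + τ (x 2) • fderiv ℝ (fun y => fderiv ℝ F y w) x u +
        (deriv (deriv τ) (x 2) * u 2 * w 2) • F x + (deriv τ (x 2) * w 2) • fderiv ℝ F x u := by
  have hFd : Differentiable ℝ F := hF.differentiable (by simp)
  have hτ' : ContDiff ℝ ∞ (deriv τ) := (contDiff_infty_iff_deriv.mp hτ).2
  have hτd : Differentiable ℝ τ := hτ.differentiable (by simp)
  have hτ'd : Differentiable ℝ (deriv τ) := hτ'.differentiable (by simp)
  have hFw : Differentiable ℝ fun y => fderiv ℝ F y w :=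
    ((hF.fderiv_right (m := ∞) (by exact_mod_cast le_rfl)).differentiable (by simp)).clm_apply (differentiable_const w)
  have h1 : (fun y : EuclideanSpace ℝ (Fin 3) => fderiv ℝ (fun z : EuclideanSpace ℝ (Fin 3) => τ (z 2) • F z) y w) =
      fun y => τ (y 2) • fderiv ℝ F y w + (fun s => deriv τ s * w 2) (y 2) • F y := by
    funext y; exact fderiv_axialWeight_smul_apply hFd hτd y w
  rw [h1]
  have hσd : Differentiable ℝ fun s => deriv τ s * w 2 := hτ'd.mul_const _
  have hA := hasFDerivAt_axialWeight_smul (V := fun y => fderiv ℝ F y w) hFw hτd x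
  have hC := hasFDerivAt_axialWeight_smul (V := F) (g := fun s => deriv τ s * w 2) hFd hσd x
  have hsum : HasFDerivAt (fun y : EuclideanSpace ℝ (Fin 3) => τ (y 2) • fderiv ℝ F y w + (fun s => deriv τ s * w 2) (y 2) • F y)
      ((τ (x 2) • fderiv ℝ (fun y => fderiv ℝ F y w) x +
        (deriv τ (x 2) • (EuclideanSpace.proj (2 : Fin 3) : EuclideanSpace ℝ (Fin 3) →L[ℝ] ℝ)).smulRight (fderiv ℝ F x w)) +
       ((deriv τ (x 2) * w 2) • fderiv ℝ F x +
        (deriv (fun s => deriv τ s * w 2) (x 2) • (EuclideanSpace.proj (2 : Fin 3) : EuclideanSpace ℝ (Fin 3) →L[ℝ] ℝ)).smulRight (F x))) x :=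
    hA.add hC
  rw [hsum.fderiv]
  have hd : deriv (fun s => deriv τ s * w 2) (x 2) = deriv (deriv τ) (x 2) * w 2 := by
    rw [deriv_mul_const (hτ'd _)]
  simp only [add_apply, smul_apply, ContinuousLinearMap.smulRight_apply, proj_two_apply, smul_eq_mul, hd]
  module

/-! ## 2. The axial derivative of the remainder `R` and the derivative of `Kⱼ` -/

/-- **`(∂₂R)(x)w = w₂(g″(x₂)ω + g′(x₂)∂₂ω) + ∂₂∂_w(g′B)(x)`**, `R = D(curl(gV)) − gDω`, `B = (−V₁, V₀, 0)`. [folklore] -/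
theorem fderiv_curlRemainder_axis_apply (hV : ContDiff ℝ ∞ V) (hg : ContDiff ℝ ∞ g) (x w : EuclideanSpace ℝ (Fin 3)) :
    (fderiv ℝ (fun y : EuclideanSpace ℝ (Fin 3) =>
        fderiv ℝ (curl (fun z : EuclideanSpace ℝ (Fin 3) => g (z 2) • V z)) y - g (y 2) • fderiv ℝ (curl V) y) x
        (EuclideanSpace.single (2 : Fin 3) (1 : ℝ))) w =
      w 2 • (deriv (deriv g) (x 2) • curl V x + deriv g (x 2) • fderiv ℝ (curl V) x (EuclideanSpace.single (2 : Fin 3) (1 : ℝ))) +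
        fderiv ℝ (fun y : EuclideanSpace ℝ (Fin 3) => fderiv ℝ (fun z : EuclideanSpace ℝ (Fin 3) => deriv g (z 2) •
          ((-V z 1) • EuclideanSpace.single (0 : Fin 3) (1 : ℝ) + (V z 0) • EuclideanSpace.single (1 : Fin 3) (1 : ℝ))) y w) x
          (EuclideanSpace.single (2 : Fin 3) (1 : ℝ)) := by
  set e₂ : EuclideanSpace ℝ (Fin 3) := EuclideanSpace.single (2 : Fin 3) (1 : ℝ) with he₂
  set L := ContinuousLinearMap.smulRightL ℝ (EuclideanSpace ℝ (Fin 3)) (EuclideanSpace ℝ (Fin 3))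
      (EuclideanSpace.proj (2 : Fin 3) : EuclideanSpace ℝ (Fin 3) →L[ℝ] ℝ) with hL
  have hproj : ContDiff ℝ ∞ fun y : EuclideanSpace ℝ (Fin 3) => y 2 :=
    (EuclideanSpace.proj (2 : Fin 3) : EuclideanSpace ℝ (Fin 3) →L[ℝ] ℝ).contDiff
  have hγ : ContDiff ℝ ∞ (deriv g) := (contDiff_infty_iff_deriv.mp hg).2
  have hγd : Differentiable ℝ (deriv g) := hγ.differentiable (by simp)
  have hω : ContDiff ℝ ∞ (curl V) := contDiff_curl (n := ⊤) (hV.of_le (by exact_mod_cast le_top))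
  have hωd : Differentiable ℝ (curl V) := hω.differentiable (by simp)
  have hB : ContDiff ℝ ∞ fun z : EuclideanSpace ℝ (Fin 3) =>
      (-V z 1) • EuclideanSpace.single (0 : Fin 3) (1 : ℝ) + (V z 0) • EuclideanSpace.single (1 : Fin 3) (1 : ℝ) :=
    contDiff_crossField hV
  have hγB : ContDiff ℝ ∞ fun z : EuclideanSpace ℝ (Fin 3) => deriv g (z 2) •
      ((-V z 1) • EuclideanSpace.single (0 : Fin 3) (1 : ℝ) + (V z 0) • EuclideanSpace.single (1 : Fin 3) (1 : ℝ)) :=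
    (hγ.comp hproj).smul hB
  have hQd : Differentiable ℝ (fderiv ℝ fun z : EuclideanSpace ℝ (Fin 3) => deriv g (z 2) •
      ((-V z 1) • EuclideanSpace.single (0 : Fin 3) (1 : ℝ) + (V z 0) • EuclideanSpace.single (1 : Fin 3) (1 : ℝ))) :=
    (hγB.fderiv_right (m := ∞) (by exact_mod_cast le_rfl)).differentiable (by simp)
  rw [curlRemainder_eq hV hg]
  have hP := hasFDerivAt_axialWeight_smul (V := curl V) (g := deriv g) hωd hγd x
  have hLP : HasFDerivAt (fun y : EuclideanSpace ℝ (Fin 3) => L (deriv g (y 2) • curl V y))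
      (L.comp (deriv g (x 2) • fderiv ℝ (curl V) x +
        (deriv (deriv g) (x 2) • (EuclideanSpace.proj (2 : Fin 3) : EuclideanSpace ℝ (Fin 3) →L[ℝ] ℝ)).smulRight (curl V x))) x :=
    L.hasFDerivAt.comp x hP
  have hsum : HasFDerivAt (fun y : EuclideanSpace ℝ (Fin 3) => L (deriv g (y 2) • curl V y) +
      fderiv ℝ (fun z : EuclideanSpace ℝ (Fin 3) => deriv g (z 2) •
        ((-V z 1) • EuclideanSpace.single (0 : Fin 3) (1 : ℝ) + (V z 0) • EuclideanSpace.single (1 : Fin 3) (1 : ℝ))) y)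
      (L.comp (deriv g (x 2) • fderiv ℝ (curl V) x +
        (deriv (deriv g) (x 2) • (EuclideanSpace.proj (2 : Fin 3) : EuclideanSpace ℝ (Fin 3) →L[ℝ] ℝ)).smulRight (curl V x)) +
        fderiv ℝ (fderiv ℝ fun z : EuclideanSpace ℝ (Fin 3) => deriv g (z 2) •
          ((-V z 1) • EuclideanSpace.single (0 : Fin 3) (1 : ℝ) + (V z 0) • EuclideanSpace.single (1 : Fin 3) (1 : ℝ))) x) x :=
    hLP.add (hQd x).hasFDerivAt
  rw [hsum.fderiv, add_apply, add_apply, fderiv_apply_comm_const (hQd x)]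
  congr 1
  simp only [ContinuousLinearMap.comp_apply, add_apply, smul_apply, ContinuousLinearMap.smulRight_apply, proj_two_apply, hL,
    smulRightL_proj_two_apply]
  rw [he₂]
  simp [smul_smul, add_comm]

/-- `D(g′V₂)(y)w = g′(y₂)(∂_wV)₂ + g″(y₂)w₂V₂`. [folklore] -/
theorem fderiv_slideCoeff_apply (hV : ContDiff ℝ ∞ V) (hg : ContDiff ℝ ∞ g) (y w : EuclideanSpace ℝ (Fin 3)) :
    fderiv ℝ (fun z : EuclideanSpace ℝ (Fin 3) => deriv g (z 2) * V z 2) y w =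
      deriv g (y 2) * fderiv ℝ V y w 2 + deriv (deriv g) (y 2) * w 2 * V y 2 := by
  have hVd : Differentiable ℝ V := hV.differentiable (by simp)
  have hγ : ContDiff ℝ ∞ (deriv g) := (contDiff_infty_iff_deriv.mp hg).2
  have hγd : Differentiable ℝ (deriv g) := hγ.differentiable (by simp)
  have h2 : DifferentiableAt ℝ (fun z : EuclideanSpace ℝ (Fin 3) => V z 2) y :=
    ((EuclideanSpace.proj (2 : Fin 3) : EuclideanSpace ℝ (Fin 3) →L[ℝ] ℝ).differentiableAt).comp y (hVd y)
  have h : HasFDerivAt (fun z : EuclideanSpace ℝ (Fin 3) => deriv g (z 2) * V z 2)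
      (deriv g (y 2) • fderiv ℝ (fun z : EuclideanSpace ℝ (Fin 3) => V z 2) y +
        V y 2 • (deriv (deriv g) (y 2) • (EuclideanSpace.proj (2 : Fin 3) : EuclideanSpace ℝ (Fin 3) →L[ℝ] ℝ))) y :=
    (hasFDerivAt_comp_coord hγd 2 y).mul h2.hasFDerivAt
  rw [h.fderiv]
  simp only [add_apply, smul_apply, smul_eq_mul, proj_two_apply, fderiv_coord_apply (hVd y) 2 w]
  ring

/-- **`DKⱼ(x)w = g″(x₂)w₂(∂ⱼV)₂(x) + g′(x₂)(∂_w∂ⱼV)₂(x)`** for `Kⱼ = ∂ⱼ(g′V₂)` and a horizontal direction `eⱼ` (`(eⱼ)₂ = 0`).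
[folklore] -/
theorem fderiv_slideCoeffDeriv_apply (hV : ContDiff ℝ ∞ V) (hg : ContDiff ℝ ∞ g) {e : EuclideanSpace ℝ (Fin 3)} (he : e 2 = 0)
    (x w : EuclideanSpace ℝ (Fin 3)) :
    fderiv ℝ (fun y : EuclideanSpace ℝ (Fin 3) => fderiv ℝ (fun z : EuclideanSpace ℝ (Fin 3) => deriv g (z 2) * V z 2) y e) x w =
      deriv (deriv g) (x 2) * w 2 * fderiv ℝ V x e 2 + deriv g (x 2) * fderiv ℝ (fun y => fderiv ℝ V y e) x w 2 := by
  have hVd : Differentiable ℝ V := hV.differentiable (by simp)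
  have hγ : ContDiff ℝ ∞ (deriv g) := (contDiff_infty_iff_deriv.mp hg).2
  have hγd : Differentiable ℝ (deriv g) := hγ.differentiable (by simp)
  have hVe : Differentiable ℝ fun y => fderiv ℝ V y e :=
    ((hV.fderiv_right (m := ∞) (by exact_mod_cast le_rfl)).differentiable (by simp)).clm_apply (differentiable_const e)
  have h1 : (fun y : EuclideanSpace ℝ (Fin 3) => fderiv ℝ (fun z : EuclideanSpace ℝ (Fin 3) => deriv g (z 2) * V z 2) y e) =
      fun y => deriv g (y 2) * fderiv ℝ V y e 2 := by
    funext y; rw [fderiv_slideCoeff_apply hV hg y e, he]; ring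
  rw [h1]
  have h2 : DifferentiableAt ℝ (fun y : EuclideanSpace ℝ (Fin 3) => fderiv ℝ V y e 2) x :=
    ((EuclideanSpace.proj (2 : Fin 3) : EuclideanSpace ℝ (Fin 3) →L[ℝ] ℝ).differentiableAt).comp x (hVe x)
  have h : HasFDerivAt (fun y : EuclideanSpace ℝ (Fin 3) => deriv g (y 2) * fderiv ℝ V y e 2)
      (deriv g (x 2) • fderiv ℝ (fun y : EuclideanSpace ℝ (Fin 3) => fderiv ℝ V y e 2) x +
        fderiv ℝ V x e 2 • (deriv (deriv g) (x 2) • (EuclideanSpace.proj (2 : Fin 3) : EuclideanSpace ℝ (Fin 3) →L[ℝ] ℝ))) x :=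
    (hasFDerivAt_comp_coord hγd 2 x).mul h2.hasFDerivAt
  rw [h.fderiv]
  simp only [add_apply, smul_apply, smul_eq_mul, proj_two_apply, fderiv_coord_apply (hVe x) 2 w]
  ring

/-! ## 3. The two densities of `ĉ₁`, summed over the basis -/

/-- `(e₀)₂ = 0`, `(e₁)₂ = 0`, `(e₂)₂ = 1` for the standard basis. [folklore] -/
theorem basisFun_apply_two :
    (EuclideanSpace.basisFun (Fin 3) ℝ 0) 2 = 0 ∧ (EuclideanSpace.basisFun (Fin 3) ℝ 1) 2 = 0 ∧
      (EuclideanSpace.basisFun (Fin 3) ℝ 2) 2 = 1 ∧ EuclideanSpace.basisFun (Fin 3) ℝ 2 = EuclideanSpace.single (2 : Fin 3) (1 : ℝ) := by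
  refine ⟨?_, ?_, ?_, ?_⟩ <;> simp [EuclideanSpace.basisFun_apply]

/-- **The remainder density of `ĉ₁`, explicitly**: with `ω = curl V`, `B = (−V₁,V₀,0)`, `R = D(curl(gV)) − gDω`,
`Σᵢ⟪∂ᵢω, (∂₂R)bᵢ⟫ = g″⟪∂₂ω, ω⟫ + g′|∂₂ω|² + g‴⟪∂₂ω, B⟫ + g″⟪∂₂ω, ∂₂B⟫ + Σᵢ(g″⟪∂ᵢω, ∂ᵢB⟫ + g′⟪∂ᵢω, ∂₂∂ᵢB⟫)`
(all weights at `x₂`; only `DV, D²V`). [folklore] -/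
theorem sum_inner_fderiv_curlRemainder_axis (hV : ContDiff ℝ ∞ V) (hg : ContDiff ℝ ∞ g) (x : EuclideanSpace ℝ (Fin 3)) :
    ∑ i : Fin 3, ⟪fderiv ℝ (curl V) x (EuclideanSpace.basisFun (Fin 3) ℝ i),
        (fderiv ℝ (fun y : EuclideanSpace ℝ (Fin 3) =>
          fderiv ℝ (curl (fun z : EuclideanSpace ℝ (Fin 3) => g (z 2) • V z)) y - g (y 2) • fderiv ℝ (curl V) y) x
          (EuclideanSpace.single (2 : Fin 3) (1 : ℝ))) (EuclideanSpace.basisFun (Fin 3) ℝ i)⟫ =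
      deriv (deriv g) (x 2) * ⟪fderiv ℝ (curl V) x (EuclideanSpace.single (2 : Fin 3) (1 : ℝ)), curl V x⟫ +
        deriv g (x 2) * ‖fderiv ℝ (curl V) x (EuclideanSpace.single (2 : Fin 3) (1 : ℝ))‖ ^ 2 +
        deriv (deriv (deriv g)) (x 2) * ⟪fderiv ℝ (curl V) x (EuclideanSpace.single (2 : Fin 3) (1 : ℝ)),
          (-V x 1) • EuclideanSpace.single (0 : Fin 3) (1 : ℝ) + (V x 0) • EuclideanSpace.single (1 : Fin 3) (1 : ℝ)⟫ +
        deriv (deriv g) (x 2) * ⟪fderiv ℝ (curl V) x (EuclideanSpace.single (2 : Fin 3) (1 : ℝ)),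
          fderiv ℝ (fun z : EuclideanSpace ℝ (Fin 3) =>
            (-V z 1) • EuclideanSpace.single (0 : Fin 3) (1 : ℝ) + (V z 0) • EuclideanSpace.single (1 : Fin 3) (1 : ℝ)) x
            (EuclideanSpace.single (2 : Fin 3) (1 : ℝ))⟫ +
        ∑ i : Fin 3, (deriv (deriv g) (x 2) * ⟪fderiv ℝ (curl V) x (EuclideanSpace.basisFun (Fin 3) ℝ i),
            fderiv ℝ (fun z : EuclideanSpace ℝ (Fin 3) =>
              (-V z 1) • EuclideanSpace.single (0 : Fin 3) (1 : ℝ) + (V z 0) • EuclideanSpace.single (1 : Fin 3) (1 : ℝ)) x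
              (EuclideanSpace.basisFun (Fin 3) ℝ i)⟫ +
          deriv g (x 2) * ⟪fderiv ℝ (curl V) x (EuclideanSpace.basisFun (Fin 3) ℝ i),
            fderiv ℝ (fun y : EuclideanSpace ℝ (Fin 3) => fderiv ℝ (fun z : EuclideanSpace ℝ (Fin 3) =>
              (-V z 1) • EuclideanSpace.single (0 : Fin 3) (1 : ℝ) + (V z 0) • EuclideanSpace.single (1 : Fin 3) (1 : ℝ)) y
              (EuclideanSpace.basisFun (Fin 3) ℝ i)) x (EuclideanSpace.single (2 : Fin 3) (1 : ℝ))⟫) := by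
  set b := EuclideanSpace.basisFun (Fin 3) ℝ with hb
  have hγ : ContDiff ℝ ∞ (deriv g) := (contDiff_infty_iff_deriv.mp hg).2
  have hB : ContDiff ℝ ∞ fun z : EuclideanSpace ℝ (Fin 3) =>
      (-V z 1) • EuclideanSpace.single (0 : Fin 3) (1 : ℝ) + (V z 0) • EuclideanSpace.single (1 : Fin 3) (1 : ℝ) :=
    contDiff_crossField hV
  have he22 : (EuclideanSpace.single (2 : Fin 3) (1 : ℝ)) 2 = 1 := by simp
  obtain ⟨hb0, hb1, hb2, hb2e⟩ := basisFun_apply_two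
  have hpt : ∀ i : Fin 3, ⟪fderiv ℝ (curl V) x (b i),
      (fderiv ℝ (fun y : EuclideanSpace ℝ (Fin 3) =>
        fderiv ℝ (curl (fun z : EuclideanSpace ℝ (Fin 3) => g (z 2) • V z)) y - g (y 2) • fderiv ℝ (curl V) y) x (EuclideanSpace.single (2 : Fin 3) (1 : ℝ))) (b i)⟫ =
      (b i) 2 * (deriv (deriv g) (x 2) * ⟪fderiv ℝ (curl V) x (b i), curl V x⟫ +
        deriv g (x 2) * ⟪fderiv ℝ (curl V) x (b i), fderiv ℝ (curl V) x (EuclideanSpace.single (2 : Fin 3) (1 : ℝ))⟫ +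
        deriv (deriv (deriv g)) (x 2) * ⟪fderiv ℝ (curl V) x (b i),
          (-V x 1) • EuclideanSpace.single (0 : Fin 3) (1 : ℝ) + (V x 0) • EuclideanSpace.single (1 : Fin 3) (1 : ℝ)⟫ +
        deriv (deriv g) (x 2) * ⟪fderiv ℝ (curl V) x (b i),
          fderiv ℝ (fun z : EuclideanSpace ℝ (Fin 3) =>
            (-V z 1) • EuclideanSpace.single (0 : Fin 3) (1 : ℝ) + (V z 0) • EuclideanSpace.single (1 : Fin 3) (1 : ℝ)) x (EuclideanSpace.single (2 : Fin 3) (1 : ℝ))⟫) +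
      (deriv (deriv g) (x 2) * ⟪fderiv ℝ (curl V) x (b i),
          fderiv ℝ (fun z : EuclideanSpace ℝ (Fin 3) =>
            (-V z 1) • EuclideanSpace.single (0 : Fin 3) (1 : ℝ) + (V z 0) • EuclideanSpace.single (1 : Fin 3) (1 : ℝ)) x (b i)⟫ +
        deriv g (x 2) * ⟪fderiv ℝ (curl V) x (b i),
          fderiv ℝ (fun y : EuclideanSpace ℝ (Fin 3) => fderiv ℝ (fun z : EuclideanSpace ℝ (Fin 3) =>
            (-V z 1) • EuclideanSpace.single (0 : Fin 3) (1 : ℝ) + (V z 0) • EuclideanSpace.single (1 : Fin 3) (1 : ℝ)) y (b i)) x (EuclideanSpace.single (2 : Fin 3) (1 : ℝ))⟫) := by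
    intro i
    rw [fderiv_curlRemainder_axis_apply hV hg x (b i), fderiv_fderiv_axialWeight_smul_apply hB hγ x (b i) (EuclideanSpace.single (2 : Fin 3) (1 : ℝ)), he22]
    simp only [inner_add_right, inner_smul_right, mul_one]
    ring
  rw [Finset.sum_congr rfl fun i _ => hpt i]
  simp only [hb, Fin.sum_univ_three, hb0, hb1, zero_mul, one_mul, zero_add, hb2e, he22, real_inner_self_eq_norm_sq]
  ring

/-- **The sliding-coefficient density of `ĉ₁`, explicitly**: with `Kⱼ = ∂ⱼ(g′V₂)`,
`Σᵢ⟪∂ᵢω, (DK₁bᵢ)e₀ − (DK₀bᵢ)e₁⟫ = g″((∂₂ω)₀(∂₁V)₂ − (∂₂ω)₁(∂₀V)₂) + g′Σᵢ((∂ᵢω)₀(∂ᵢ∂₁V)₂ − (∂ᵢω)₁(∂ᵢ∂₀V)₂)`. [folklore] -/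
theorem sum_inner_slideCoeffDeriv (hV : ContDiff ℝ ∞ V) (hg : ContDiff ℝ ∞ g) (x : EuclideanSpace ℝ (Fin 3)) :
    ∑ i : Fin 3, ⟪fderiv ℝ (curl V) x (EuclideanSpace.basisFun (Fin 3) ℝ i),
        (fderiv ℝ (fun y : EuclideanSpace ℝ (Fin 3) => fderiv ℝ (fun z : EuclideanSpace ℝ (Fin 3) => deriv g (z 2) * V z 2) y (EuclideanSpace.single (1 : Fin 3) (1 : ℝ))) x (EuclideanSpace.basisFun (Fin 3) ℝ i)) • EuclideanSpace.single (0 : Fin 3) (1 : ℝ) -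
          (fderiv ℝ (fun y : EuclideanSpace ℝ (Fin 3) => fderiv ℝ (fun z : EuclideanSpace ℝ (Fin 3) => deriv g (z 2) * V z 2) y (EuclideanSpace.single (0 : Fin 3) (1 : ℝ))) x (EuclideanSpace.basisFun (Fin 3) ℝ i)) • EuclideanSpace.single (1 : Fin 3) (1 : ℝ)⟫ =
      deriv (deriv g) (x 2) * (fderiv ℝ (curl V) x (EuclideanSpace.single (2 : Fin 3) (1 : ℝ)) 0 * fderiv ℝ V x (EuclideanSpace.single (1 : Fin 3) (1 : ℝ)) 2 -
          fderiv ℝ (curl V) x (EuclideanSpace.single (2 : Fin 3) (1 : ℝ)) 1 * fderiv ℝ V x (EuclideanSpace.single (0 : Fin 3) (1 : ℝ)) 2) +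
        deriv g (x 2) * ∑ i : Fin 3, (fderiv ℝ (curl V) x (EuclideanSpace.basisFun (Fin 3) ℝ i) 0 *
            fderiv ℝ (fun y => fderiv ℝ V y (EuclideanSpace.single (1 : Fin 3) (1 : ℝ))) x (EuclideanSpace.basisFun (Fin 3) ℝ i) 2 -
          fderiv ℝ (curl V) x (EuclideanSpace.basisFun (Fin 3) ℝ i) 1 *
            fderiv ℝ (fun y => fderiv ℝ V y (EuclideanSpace.single (0 : Fin 3) (1 : ℝ))) x (EuclideanSpace.basisFun (Fin 3) ℝ i) 2) := by
  set b := EuclideanSpace.basisFun (Fin 3) ℝ with hb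
  have he1 : (EuclideanSpace.single (1 : Fin 3) (1 : ℝ)) 2 = 0 := by simp
  have he0 : (EuclideanSpace.single (0 : Fin 3) (1 : ℝ)) 2 = 0 := by simp
  obtain ⟨hb0, hb1, hb2, hb2e⟩ := basisFun_apply_two
  have hpt : ∀ i : Fin 3, ⟪fderiv ℝ (curl V) x (b i),
      (fderiv ℝ (fun y : EuclideanSpace ℝ (Fin 3) => fderiv ℝ (fun z : EuclideanSpace ℝ (Fin 3) => deriv g (z 2) * V z 2) y (EuclideanSpace.single (1 : Fin 3) (1 : ℝ))) x (b i)) • EuclideanSpace.single (0 : Fin 3) (1 : ℝ) -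
        (fderiv ℝ (fun y : EuclideanSpace ℝ (Fin 3) => fderiv ℝ (fun z : EuclideanSpace ℝ (Fin 3) => deriv g (z 2) * V z 2) y (EuclideanSpace.single (0 : Fin 3) (1 : ℝ))) x (b i)) • EuclideanSpace.single (1 : Fin 3) (1 : ℝ)⟫ =
      (b i) 2 * (deriv (deriv g) (x 2) * (fderiv ℝ (curl V) x (b i) 0 * fderiv ℝ V x (EuclideanSpace.single (1 : Fin 3) (1 : ℝ)) 2 -
        fderiv ℝ (curl V) x (b i) 1 * fderiv ℝ V x (EuclideanSpace.single (0 : Fin 3) (1 : ℝ)) 2)) +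
      deriv g (x 2) * (fderiv ℝ (curl V) x (b i) 0 * fderiv ℝ (fun y => fderiv ℝ V y (EuclideanSpace.single (1 : Fin 3) (1 : ℝ))) x (b i) 2 -
        fderiv ℝ (curl V) x (b i) 1 * fderiv ℝ (fun y => fderiv ℝ V y (EuclideanSpace.single (0 : Fin 3) (1 : ℝ))) x (b i) 2) := by
    intro i
    rw [fderiv_slideCoeffDeriv_apply hV hg he1 x (b i), fderiv_slideCoeffDeriv_apply hV hg he0 x (b i)]
    rw [inner_sub_right, inner_smul_right, inner_smul_right, EuclideanSpace.inner_single_right, EuclideanSpace.inner_single_right]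
    simp only [conj_trivial, one_mul]
    ring
  rw [Finset.sum_congr rfl fun i _ => hpt i]
  have he22 : (EuclideanSpace.single (2 : Fin 3) (1 : ℝ)) 2 = 1 := by simp
  simp only [hb, Fin.sum_univ_three, hb0, hb1, zero_mul, one_mul, zero_add, hb2e, he22]
  ring

end ExtremiserLiouville

end Summit.NavierStokesRegularity.NavierStokesRegularity.Theorems

end
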